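import Mathlib
import HarnessLib
import Summits.CriticalPhenomena.PercolationContinuityZ3.Theorems.PercNearOneGluingNoHeavyLowerTailAPLVwStep

/-!
# `NoHeavyLowerTail` (stmt-CriticalPhenomena-4575) — (V_w) vertex by vertex: the per-vertex split and its apex-edge step

Support file (prover prim-ineq-gen-8 gen 42; `--supports stmt-CriticalPhenomena-4575`; memo
run/shared/lean/prim/prim-ineq-gen-8/FINDING-gen42-PERVERTEX.md).  No definitions, no named facts, no sorries; pure real algebra.

Context (memo §1).  For bond percolation with a glued apex set `S`, loads `ℓ ≥ 0`, `I_v = 1[S ~ v]`, `L = Σ_u ℓ_u I_u` and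
`R = Σ_v ℓ_v Z_v`, `Z_v := 1[S ≁ v]·ℓ(C_v)` (so `R` is the sum of the squared loads of the clusters not glued to `S`), gen 40/41's
target (V_w) `T := Σ_v ℓ_v Cov(I_v,L)²/P(I_v) + 2Cov(L,R) ≤ 0` regroups EXACTLY as `T = Σ_v ℓ_v T_v` with the per-vertex functional
`T_v := N_v²/p_v + 2G_v`, `N_v = Cov(I_v,L)`, `p_v = P(I_v)`, `G_v = Cov(L, Z_v)` (attribute the `2Cov(L,R)` term to the CLUSTER index `v`
of `R = Σ_v ℓ_v Z_v`; the attribution to the `I`-index used before fails vertex by vertex).  Numerically `T_v ≤ 0` for every vertex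
(conjecture (PV) of the memo, sup of `N_v²/(p_v·2|G_v|)` = 1⁻ over > 10⁴ random and adversarial instances), and (PV) ⟹ (V_w) by
`pv_sum_nonpos`.  Along the weight `z` of an apex edge `e = sy` every statistic is an affine mixture of the endpoint instances
`(w∖e, S)` and `(w∖e, S∪{y})` except for the covariance cross terms: `N_v(z) = (1−z)N⁰ + zN¹ + z(1−z)δd`,
`G_v(z) = (1−z)G⁰ + zG¹ − z(1−z)dm`, `p_v(z) = (1−z)p⁰ + zp¹`, with `δ = μ₀(S≁v, y∈C_v)`, `d = E₀[ℓ(C_y); S≁y]`,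
`m = E₀[ℓ(C_v); S≁v, y∈C_v]`.  For a FIXED test value `λ` the linearised functional `Ψ_λ := 2λN_v + 2G_v − λ²p_v` (whose supremum over
`λ` is `T_v`, attained at the boost `λ = N_v/p_v`) is then a quadratic in `z` with the explicit bump `2z(1−z)d(λδ − m)`
(`pv_mixture_identity`); it is ≤ its chord, hence ≤ 0 given the endpoint instances, as soon as `λδ ≤ m`, i.e. as soon as the boost
`Δ_v = N_v/p_v` is at most `b_{v,y} := m/δ = E[ℓ(C_v) | S≁v, y∈C_v]` (`pv_step_nonpos`, `pv_Tv_step`).  So (PV) — hence (V_w), (V) and,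
with the proved (P), (Q0) — follows by induction on the number of apex edges from the SELECTION statement (SEL) of the memo:
every vertex `v` has an apex-neighbour `y` with `Δ_v ≤ b_{v,y}` (numerically: sup `Δ_v / max_y b_{v,y}` = 1⁻, never exceeded).
This file is the algebraic skeleton of that induction; (SEL) is open.
[this work]
-/

noncomputable section

namespace Summit.CriticalPhenomena.PercolationContinuityZ3.Theorems

namespace APL

open Finset
open scoped BigOperators

/-! ### The linearised per-vertex functional along an apex edge -/

/-- **Mixture identity for the linearised per-vertex functional.**  With `N(z) = (1−z)N⁰ + zN¹ + z(1−z)δd`,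
`G(z) = (1−z)G⁰ + zG¹ − z(1−z)dm`, `p(z) = (1−z)p⁰ + zp¹` and `Ψ_λ = 2λN + 2G − λ²p`:
`Ψ_λ(z) = (1−z)Ψ_λ⁰ + zΨ_λ¹ + 2z(1−z)d(λδ − m)`. [this work] -/
theorem pv_mixture_identity (lam N0 N1 G0 G1 p0 p1 d δ m z : ℝ) :
    2 * lam * ((1 - z) * N0 + z * N1 + z * (1 - z) * δ * d)
        + 2 * ((1 - z) * G0 + z * G1 - z * (1 - z) * d * m) - lam ^ 2 * ((1 - z) * p0 + z * p1) =
      (1 - z) * (2 * lam * N0 + 2 * G0 - lam ^ 2 * p0) + z * (2 * lam * N1 + 2 * G1 - lam ^ 2 * p1)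
        + 2 * z * (1 - z) * d * (lam * δ - m) := by
  ring

/-- **Per-vertex step at a fixed test value.**  If `d ≥ 0`, the selection criterion `λδ ≤ m` holds and `Ψ_λ ≤ 0` at both endpoint
instances, then `Ψ_λ(z) ≤ 0` for every `z ∈ [0,1]`. [this work] -/
theorem pv_step_nonpos (lam N0 N1 G0 G1 p0 p1 d δ m z : ℝ) (hz0 : 0 ≤ z) (hz1 : z ≤ 1) (hd : 0 ≤ d)
    (hsel : lam * δ ≤ m) (h0 : 2 * lam * N0 + 2 * G0 - lam ^ 2 * p0 ≤ 0) (h1 : 2 * lam * N1 + 2 * G1 - lam ^ 2 * p1 ≤ 0) :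
    2 * lam * ((1 - z) * N0 + z * N1 + z * (1 - z) * δ * d)
        + 2 * ((1 - z) * G0 + z * G1 - z * (1 - z) * d * m) - lam ^ 2 * ((1 - z) * p0 + z * p1) ≤ 0 := by
  rw [pv_mixture_identity]
  have hz' : 0 ≤ 1 - z := by linarith
  have hA : (1 - z) * (2 * lam * N0 + 2 * G0 - lam ^ 2 * p0) ≤ 0 := mul_nonpos_of_nonneg_of_nonpos hz' h0
  have hB : z * (2 * lam * N1 + 2 * G1 - lam ^ 2 * p1) ≤ 0 := mul_nonpos_of_nonneg_of_nonpos hz0 h1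
  have hC : 2 * z * (1 - z) * d * (lam * δ - m) ≤ 0 := by
    have h2 : 0 ≤ 2 * z * (1 - z) * d := by positivity
    exact mul_nonpos_of_nonneg_of_nonpos h2 (by linarith)
  linarith

/-- The per-vertex functional dominates every linearisation: for `p > 0`, `2λN + 2G − λ²p ≤ N²/p + 2G`. [folklore] -/
theorem pv_lin_le (lam N G p : ℝ) (hp : 0 < p) : 2 * lam * N + 2 * G - lam ^ 2 * p ≤ N ^ 2 / p + 2 * G := by
  have := vw_sq_div_ge N p lam hp
  linarith

/-- … with equality at the boost `λ = N/p`. [folklore] -/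
theorem pv_lin_eq (N G p : ℝ) (hp : 0 < p) : 2 * (N / p) * N + 2 * G - (N / p) ^ 2 * p = N ^ 2 / p + 2 * G := by
  have := vw_sq_div_eq N p hp
  linarith

/-- **Per-vertex step for `T_v = N²/p + 2G`.**  Endpoint data `p⁰, p¹ > 0` with `T_v ≤ 0` at both endpoint instances, increments
`d ≥ 0`, `δ`, `m`, and the selection criterion at the interpolated boost `λ* = N(z)/p(z)`: `λ*·δ ≤ m`.  Then `T_v(z) ≤ 0`.
(Percolation reading: if the boost `Δ_v(z)` is at most `b_{v,y} = E[ℓ(C_v) | S≁v, y∈C_v]` for the apex edge `sy` being varied, the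
per-vertex inequality (PV) propagates to weight `z` from the two smaller instances.) [this work] -/
theorem pv_Tv_step (N0 N1 G0 G1 p0 p1 d δ m z : ℝ) (hp0 : 0 < p0) (hp1 : 0 < p1) (hz0 : 0 ≤ z) (hz1 : z ≤ 1)
    (hd : 0 ≤ d) (hT0 : N0 ^ 2 / p0 + 2 * G0 ≤ 0) (hT1 : N1 ^ 2 / p1 + 2 * G1 ≤ 0)
    (hsel : ((1 - z) * N0 + z * N1 + z * (1 - z) * δ * d) / ((1 - z) * p0 + z * p1) * δ ≤ m) :
    ((1 - z) * N0 + z * N1 + z * (1 - z) * δ * d) ^ 2 / ((1 - z) * p0 + z * p1)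
        + 2 * ((1 - z) * G0 + z * G1 - z * (1 - z) * d * m) ≤ 0 := by
  have hpz : 0 < (1 - z) * p0 + z * p1 := by
    rcases eq_or_lt_of_le hz1 with h | h
    · subst h; simpa using hp1
    · have : 0 < (1 - z) * p0 := mul_pos (by linarith) hp0
      have : 0 ≤ z * p1 := mul_nonneg hz0 hp1.le
      linarith
  set lam := ((1 - z) * N0 + z * N1 + z * (1 - z) * δ * d) / ((1 - z) * p0 + z * p1) with hlam
  have h0 : 2 * lam * N0 + 2 * G0 - lam ^ 2 * p0 ≤ 0 := le_trans (pv_lin_le lam N0 G0 p0 hp0) hT0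
  have h1 : 2 * lam * N1 + 2 * G1 - lam ^ 2 * p1 ≤ 0 := le_trans (pv_lin_le lam N1 G1 p1 hp1) hT1
  have hstep := pv_step_nonpos lam N0 N1 G0 G1 p0 p1 d δ m z hz0 hz1 hd hsel h0 h1
  have heq := pv_lin_eq ((1 - z) * N0 + z * N1 + z * (1 - z) * δ * d)
    ((1 - z) * G0 + z * G1 - z * (1 - z) * d * m) ((1 - z) * p0 + z * p1) hpz
  rw [← hlam] at heq
  linarith

/-! ### From the per-vertex inequality to (V_w) -/

/-- **Regrouping.**  `Σ_v ℓ_v (N_v²/p_v + 2G_v) = Σ_v ℓ_v N_v²/p_v + 2 Σ_v ℓ_v G_v`; with `Σ_v ℓ_v G_v = Cov(L,R)` (the cluster-index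
attribution of `R = Σ_v ℓ_v Z_v`) the right side is gen 40/41's `T = W + 2Cov(L,R)`. [this work] -/
theorem pv_regroup {U : Type*} [Fintype U] (ℓ N p G : U → ℝ) :
    ∑ v, ℓ v * (N v ^ 2 / p v + 2 * G v) = ∑ v, ℓ v * (N v ^ 2 / p v) + 2 * ∑ v, ℓ v * G v := by
  rw [Finset.mul_sum, ← Finset.sum_add_distrib]
  apply Finset.sum_congr rfl
  intro v _
  ring

/-- **(PV) ⟹ (V_w).**  If every per-vertex functional is `≤ 0` and the loads are non-negative, then
`W + 2C = Σ_v ℓ_v N_v²/p_v + 2Σ_v ℓ_v G_v ≤ 0`. [this work] -/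
theorem pv_sum_nonpos {U : Type*} [Fintype U] (ℓ N p G : U → ℝ) (hℓ : ∀ v, 0 ≤ ℓ v)
    (hPV : ∀ v, N v ^ 2 / p v + 2 * G v ≤ 0) :
    ∑ v, ℓ v * (N v ^ 2 / p v) + 2 * ∑ v, ℓ v * G v ≤ 0 := by
  rw [← pv_regroup]
  apply Finset.sum_nonpos
  intro v _
  exact mul_nonpos_of_nonneg_of_nonpos (hℓ v) (hPV v)

/-- **Selection by the best apex neighbour.**  The criterion of `pv_Tv_step` only has to hold for ONE apex edge: if `δ_y > 0` and
`λ ≤ m_y/δ_y` for some `y` (i.e. `Δ_v ≤ max_y b_{v,y}`, statement (SEL) of the memo), then `λδ_y ≤ m_y` for that `y`. [this work] -/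
theorem pv_sel_of_le_ratio (lam δ m : ℝ) (hδ : 0 < δ) (h : lam ≤ m / δ) : lam * δ ≤ m := by
  rwa [le_div_iff₀ hδ] at h

end APL

end Summit.CriticalPhenomena.PercolationContinuityZ3.Theorems

end
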